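import Literature.NumberTheory.GaloisRepresentations.GlobalReciprocityCyclicDescentProofs
import Mathlib.NumberTheory.LegendreSymbol.QuadraticChar.Basic
import HarnessLib

/-!
# The genus Hecke character `χ_ε = ε_p ∘ N_{K/ℚ}` of a number field `K` at an odd prime `p`

Definition item asked by the BSD cell `bsd-schneider-ideate` (P2 gen 13, 2026-08-27, door memo
`door-c3-g8-branch-currency.md` §3; spec file `memos/door-c3-g8/KYBranchSpec.lean`): the BRANCH
CHARACTER of Keller–Yin's Heegner pair `(f̃, χ_ε)`, "`χ_ε := ε⁻¹ ∘ Nm_{K/ℚ}`" (T. Keller, M. Yin,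
arXiv:2410.23241, Prop. 3.1.3 and its proof, p. 14), for the quadratic Dirichlet character
`ε = ε_p = (·/p)` of conductor `p` (`ε⁻¹ = ε`), as a Hecke character of `K` in the tree's currency:
`HeckeCharacter.ofDirichlet` (the Hecke character `ψ_ε` of `ℚ` with `ψ_ε(ϖ_ℓ) = ε(ℓ)` for `ℓ ≠ p`,
`HeckeCharacterProofs.lean`) composed with the idelic norm `N_{K/ℚ}` (`HeckeCharacter.compRelNorm`,
`GlobalArtinMapNormProofs.lean`). A DEFINITION with a body plus the two cheap API lemmas the
consumer owes to `castellaHsieh2018_exists_isBranchBDPLFunction` (`CastellaHsieh2018/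
BranchBDPLFunctionExistence.lean`): `χ_ε² = 1` and `χ_ε` unramified at every finite `w ∤ p`.
NOT here (next item, genuinely local): the conductor exponent of `χ_ε` at `w ∣ p` is exactly `1`
(`HeckeCharacter.HasConductorExponentAt (genusHeckeCharacter K p) w 1` for `p` odd and `w ∣ p` of
degree one) — it needs the local component of `HeckeCharacter.ofDirichlet` at the ramified prime
(`Rat.rayClassHom_eq_redMod`) and the idelic norm on local units at a split place; recorded as a
TODO, no `sorry`, no fact.

* `genusHeckeCharacter K p` — the definition (`[IsGalois ℚ K]` is required by `compRelNorm`).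
* `genusHeckeCharacter_sq` — `χ_ε ^ 2 = 1`.
* `genusHeckeCharacter_isUnramifiedAt` — unramified at `w` whenever `(p : 𝓞 K) ∉ w`.

References: [KellerYin2024b] Prop. 3.1.3 (p. 14), §3.4 (p. 19); [NeukirchANT1999] Ch. VII
Prop. (6.9) (Dirichlet ↦ Hecke); [CasselsFrohlichANT1967] Ch. VII §4.3 (`ψ ∘ N`).
-/

noncomputable section

open scoped NumberField
open NumberField IsDedekindDomain IsDedekindDomain.HeightOneSpectrum Rat.HeightOneSpectrum

namespace Literature.NumberTheory.GaloisRepresentations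

variable (K : Type) [Field K] [NumberField K] [IsGalois ℚ K] (p : ℕ) [Fact p.Prime]

/-- **The genus character `χ_ε = ε_p ∘ N_{K/ℚ}`** of the number field `K` (Galois over `ℚ`) at the
prime `p`: the Hecke character of `K` obtained by composing the Hecke character of the quadratic
Dirichlet character `ε_p = (·/p)` mod `p` (`quadraticChar (ZMod p)`, values in `ℤ ⊂ ℂ`) with the
idelic norm `N_{K/ℚ}`. For `K` imaginary quadratic with `p` odd and split this is Keller–Yin's
branch character "`χ_ε := ε⁻¹ ∘ Nm_{K/ℚ}`" (`ε⁻¹ = ε`), a quadratic Hecke character of `K` of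
conductor `p𝓞_K`, trivial on `𝔸_ℚ^×` ("`χ_ε|_{𝔸_ℚ^×} = ε^{−2}`", loc. cit.).
[cite: KellerYin2024b, Prop. 3.1.3 and proof (arXiv:2410.23241 p. 14)]
[cite: NeukirchANT1999, Ch. VII Prop. (6.9)] -/
def genusHeckeCharacter : HeckeCharacter K :=
  (HeckeCharacter.ofDirichlet ((quadraticChar (ZMod p)).ringHomComp (Int.castRingHom ℂ))).compRelNorm K

/-- Unfolding lemma. [cite: KellerYin2024b, Prop. 3.1.3 (p. 14)] -/
theorem genusHeckeCharacter_def : genusHeckeCharacter K p =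
    (HeckeCharacter.ofDirichlet
      ((quadraticChar (ZMod p)).ringHomComp (Int.castRingHom ℂ))).compRelNorm K := rfl

/-- The Hecke character of a quadratic Dirichlet character squares to `1` (`ε² = 1`, so
`ψ_ε² = ψ_{ε²} = 1`; Keller–Yin: "`ε^{−2}`" is trivial for the quadratic `ε`).
[cite: NeukirchANT1999, Ch. VII Prop. (6.9)] [cite: KellerYin2024b, Prop. 3.1.3 (p. 14)] -/
theorem ofDirichlet_quadraticChar_sq :
    HeckeCharacter.ofDirichlet ((quadraticChar (ZMod p)).ringHomComp (Int.castRingHom ℂ)) ^ 2 = 1 := by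
  refine HeckeCharacter.ext fun x => ?_
  rw [HeckeCharacter.pow_apply, HeckeCharacter.ofDirichlet_apply, inv_pow, ← map_pow,
    HeckeCharacter.one_apply, inv_eq_one]
  set u : (ZMod p)ˣ := Rat.rayClassHom p x with hu
  have hsq : u ^ 2 = u * u := sq u
  apply Units.ext
  rw [MulChar.coe_toUnitHom, hsq, Units.val_mul, map_mul, MulChar.ringHomComp_apply,
    Units.val_one, ← map_mul, ← sq, quadraticChar_sq_one u.isUnit.ne_zero, map_one]

/-- **`χ_ε² = 1`**: the genus character is quadratic. [cite: KellerYin2024b, Prop. 3.1.3 (p. 14)] -/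
theorem genusHeckeCharacter_sq : genusHeckeCharacter K p ^ 2 = 1 := by
  rw [genusHeckeCharacter_def, ← HeckeCharacter.compRelNorm_pow, ofDirichlet_quadraticChar_sq]
  refine HeckeCharacter.ext fun y => ?_
  rw [HeckeCharacter.compRelNorm_apply, HeckeCharacter.one_apply, HeckeCharacter.one_apply]

/-- **`χ_ε` is unramified away from `p`**: at every finite place `w` of `K` with `p ∉ w`.
[cite: KellerYin2024b, Prop. 3.1.3 (p. 14)] -/
theorem genusHeckeCharacter_isUnramifiedAt (w : HeightOneSpectrum (𝓞 K))
    (hw : ((p : ℕ) : 𝓞 K) ∉ w.asIdeal) : (genusHeckeCharacter K p).IsUnramifiedAt w := by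
  rw [genusHeckeCharacter_def]
  refine HeckeCharacter.compRelNorm_isUnramifiedAt _ (HeckeCharacter.isUnramifiedAt_ofDirichlet _ ?_)
  intro hdvd
  apply hw
  have hgen : natGenerator (w.under (𝓞 ℚ)) = p :=
    (Nat.prime_dvd_prime_iff_eq (primesEquiv (w.under (𝓞 ℚ))).2 (Fact.out)).mp hdvd
  have h1 : ((p : ℕ) : 𝓞 ℚ) ∈ (w.under (𝓞 ℚ)).asIdeal := by
    rw [Rat.natCast_mem_asIdeal_iff, hgen]
  have h2 : algebraMap (𝓞 ℚ) (𝓞 K) ((p : ℕ) : 𝓞 ℚ) ∈ w.asIdeal := h1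
  rwa [map_natCast] at h2

-- TODO(next item): `(genusHeckeCharacter K p).HasConductorExponentAt w 1` for `p` odd and
-- `(p : 𝓞 K) ∈ w.asIdeal` of degree one (Legendre symbol on `ℤ_p^×`, trivial on `1 + pℤ_p`).

end Literature.NumberTheory.GaloisRepresentations

end
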